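import Literature.MathematicalPhysics.QuantumFieldTheory.Balaban1983to89.B7BlockAvgLog

/-!
# The series logarithm (21) of [Balaban1985Averaging] §A is LIPSCHITZ on every closed ball `‖X − 1‖ ≤ r < 1`
# (constant `(1 − r)⁻¹`), and `log X⁻¹ = −log X` out to radius `2/5`

Companion of the tree's `MatrixLog` (the series logarithm `mlog X = logOnePlus (X − 1)`, (21) p. 21, with the printed
bounds (26)–(27)) and of `BlockAveragingExpMeanLog` (`ExpMeanLog.mlog_eq_neg_of_mul_eq_one` at radius `1/3`).  Two
elementary facts about the same object that those files do not record and that the NONLINEAR form of [Balaban1987RG1]'s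
p. 266–267 rider (cell `pub-ymgap`, node N09, file `B12B0RestrictionNonlinear267`) consumes:

* `norm_logOnePlus_sub_logOnePlus_le` ∕ `norm_mlog_sub_mlog_le`: for `‖x‖, ‖y‖ ≤ r < 1`,
  `‖log(1+x) − log(1+y)‖ ≤ ‖x − y‖∕(1 − r)` — termwise, from the non-commutative telescoping
  `‖xⁿ − yⁿ‖ ≤ n rⁿ⁻¹ ‖x − y‖` (`norm_pow_succ_sub_pow_succ_le`) and `Σ_{n≥1} (1/n)·n rⁿ⁻¹ = (1 − r)⁻¹`;
* `mlog_eq_neg_of_mul_eq_one_of_le`: `XY = 1`, `‖X − 1‖ ≤ 2/5` ⇒ `log Y = −log X` (the tree's argument, with the radius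
  `1/3` relaxed to `2/5`: all it needs is `‖log X‖ < ln 2`, and `‖log X‖ ≤ (2/5)/(3/5) = 2/3 < ln 2` by (26));
* `norm_mlog_le_two_thirds`: `‖X − 1‖ ≤ 2/5 ⇒ ‖log X‖ ≤ 2/3`.

Cell `pub-ymgap` (YM-PLAN Track A), seat `pub-ymgap-dag-n09-w4` g3; helper toward K1⁷ `StabilityBAtRecordR13SepCoPH`
(stmt-QuantumFields-20542), count-neutral.  HONEST FRAMING: kernel facts about a power series in a complete normed
`ℂ`-algebra; nothing of Bałaban's estimates is asserted; no summit statement is touched; one finite-torus programme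
downstream — not continuum ∕ ℝ⁴ ∕ OS ∕ mass gap ∕ Clay.  Theorems only (0 `def`, 0 `sorry`, 0 `instance`).
-/

open NormedSpace

namespace Literature.MathematicalPhysics.QuantumFieldTheory.Balaban1983to89

namespace MatrixLogLipschitz

open Literature.Analysis.Complex (logOnePlus logSeriesCoeff summable_logOnePlus)
open MatrixLog

noncomputable section

variable {𝔄 : Type*} [NormedRing 𝔄] [NormedAlgebra ℂ 𝔄]

omit [NormedAlgebra ℂ 𝔄] in
/-- **Non-commutative telescoping**: `‖x^{n+1} − y^{n+1}‖ ≤ (n+1)·rⁿ·‖x − y‖` whenever `‖x‖, ‖y‖ ≤ r`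
(`x^{n+2} − y^{n+2} = x(x^{n+1} − y^{n+1}) + (x − y)y^{n+1}`). [folklore] -/
private theorem norm_pow_succ_sub_pow_succ_le {x y : 𝔄} {r : ℝ} (hx : ‖x‖ ≤ r) (hy : ‖y‖ ≤ r) :
    ∀ n : ℕ, ‖x ^ (n + 1) - y ^ (n + 1)‖ ≤ (n + 1) * r ^ n * ‖x - y‖
  | 0 => by simp
  | n + 1 => by
    have hr : 0 ≤ r := (norm_nonneg x).trans hx
    have ih := norm_pow_succ_sub_pow_succ_le hx hy n
    have e : x ^ (n + 2) - y ^ (n + 2) = x * (x ^ (n + 1) - y ^ (n + 1)) + (x - y) * y ^ (n + 1) := by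
      simp only [pow_succ']; noncomm_ring
    rw [e]
    calc ‖x * (x ^ (n + 1) - y ^ (n + 1)) + (x - y) * y ^ (n + 1)‖
        ≤ ‖x‖ * ‖x ^ (n + 1) - y ^ (n + 1)‖ + ‖x - y‖ * ‖y ^ (n + 1)‖ :=
          (norm_add_le _ _).trans (add_le_add (norm_mul_le _ _) (norm_mul_le _ _))
      _ ≤ r * ((n + 1) * r ^ n * ‖x - y‖) + ‖x - y‖ * r ^ (n + 1) := by
          refine add_le_add (mul_le_mul hx ih (norm_nonneg _) hr) (mul_le_mul_of_nonneg_left ?_ (norm_nonneg _))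
          exact (norm_pow_le' y (Nat.succ_pos n)).trans (pow_le_pow_left₀ (norm_nonneg y) hy _)
      _ = ((n + 1 : ℕ) + 1) * r ^ (n + 1) * ‖x - y‖ := by push_cast; ring

variable [CompleteSpace 𝔄]

/-- **THE SERIES LOGARITHM IS `(1 − r)⁻¹`-LIPSCHITZ ON `‖·‖ ≤ r < 1`**: `‖log(1+x) − log(1+y)‖ ≤ ‖x − y‖∕(1 − r)` for
`‖x‖, ‖y‖ ≤ r < 1` (termwise: `Σ_{n≥1} (1/n)‖xⁿ − yⁿ‖ ≤ Σ_{n≥1} rⁿ⁻¹‖x − y‖`) — the series (21) read at `X = 1 + x`.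
[cite: Balaban1985Averaging, (21) p.21] -/
theorem norm_logOnePlus_sub_logOnePlus_le {x y : 𝔄} {r : ℝ} (hr : r < 1) (hx : ‖x‖ ≤ r) (hy : ‖y‖ ≤ r) :
    ‖logOnePlus x - logOnePlus y‖ ≤ ‖x - y‖ / (1 - r) := by
  have hr0 : 0 ≤ r := (norm_nonneg x).trans hx
  have hx1 : ‖x‖ < 1 := hx.trans_lt hr
  have hy1 : ‖y‖ < 1 := hy.trans_lt hr
  have hsx := summable_logOnePlus hx1
  have hsy := summable_logOnePlus hy1
  have hsub : Summable fun n : ℕ => logSeriesCoeff n • x ^ n - logSeriesCoeff n • y ^ n := hsx.sub hsy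
  have e : logOnePlus x - logOnePlus y = ∑' n : ℕ, (logSeriesCoeff n • x ^ n - logSeriesCoeff n • y ^ n) := by
    rw [hsx.tsum_sub hsy]; rfl
  rw [e, hsub.tsum_eq_zero_add]
  simp only [pow_zero, sub_self, zero_add]
  have hgeom : HasSum (fun n : ℕ => ‖x - y‖ * r ^ n) (‖x - y‖ / (1 - r)) := by
    rw [div_eq_mul_inv]
    exact (hasSum_geometric_of_lt_one hr0 hr).mul_left ‖x - y‖
  refine tsum_of_norm_bounded hgeom fun n => ?_
  rw [← smul_sub]
  refine (norm_smul_le _ _).trans ?_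
  rw [norm_logSeriesCoeff_succ]
  have h := norm_pow_succ_sub_pow_succ_le hx hy n
  have hn : (0 : ℝ) < n + 1 := by positivity
  calc 1 / ((n : ℝ) + 1) * ‖x ^ (n + 1) - y ^ (n + 1)‖ ≤ 1 / ((n : ℝ) + 1) * ((n + 1) * r ^ n * ‖x - y‖) :=
        mul_le_mul_of_nonneg_left h (by positivity)
    _ = ‖x - y‖ * r ^ n := by rw [one_div, mul_assoc ((n : ℝ) + 1), inv_mul_cancel_left₀ hn.ne', mul_comm]

/-- **(21) IS `(1 − r)⁻¹`-LIPSCHITZ ON `‖X − 1‖ ≤ r < 1`**: `‖log A − log B‖ ≤ ‖A − B‖∕(1 − r)`.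
[cite: Balaban1985Averaging, (21) p.21] -/
theorem norm_mlog_sub_mlog_le {A B : 𝔄} {r : ℝ} (hr : r < 1) (hA : ‖A - 1‖ ≤ r) (hB : ‖B - 1‖ ≤ r) :
    ‖mlog A - mlog B‖ ≤ ‖A - B‖ / (1 - r) := by
  rw [mlog_def, mlog_def]
  have h := norm_logOnePlus_sub_logOnePlus_le hr hA hB
  rwa [sub_sub_sub_cancel_right] at h

/-- `‖X − 1‖ ≤ 2/5 ⇒ ‖log X‖ ≤ 2/3` ((26): `‖log X‖ ≤ ‖X − 1‖∕(1 − ‖X − 1‖)`). [cite: Balaban1985Averaging, (26) p.22] -/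
theorem norm_mlog_le_two_thirds {X : 𝔄} (hX : ‖X - 1‖ ≤ 2 / 5) : ‖mlog X‖ ≤ 2 / 3 := by
  have hX1 : ‖X - 1‖ < 1 := hX.trans_lt (by norm_num)
  refine (norm_mlog_le_div hX1).trans ?_
  rw [div_le_iff₀ (by linarith)]
  linarith [norm_nonneg (X - 1)]

/-- `2/3 < ln 2`. [folklore] -/
private theorem two_thirds_lt_log_two : (2 : ℝ) / 3 < Real.log 2 := by
  have := Real.log_two_gt_d9; linarith

/-- **`log Y = −log X` for `XY = 1`, `‖X − 1‖ ≤ 2/5`** — the tree's `ExpMeanLog.mlog_eq_neg_of_mul_eq_one` with the radius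
`1/3` relaxed to `2/5` (the argument needs only `‖log X‖ < ln 2`): `Y = X⁻¹ = e^{−log X}` by `e^{log X} = X`, then
`log e^{−log X} = −log X` («It is an inverse to the exponential function», p. 21). [cite: Balaban1985Averaging, (21) p.21] -/
theorem mlog_eq_neg_of_mul_eq_one_of_le {X Y : 𝔄} (hXY : X * Y = 1) (hX : ‖X - 1‖ ≤ 2 / 5) :
    mlog Y = -mlog X := by
  letI : NormedAlgebra ℚ 𝔄 := NormedAlgebra.restrictScalars ℚ ℂ 𝔄
  have hX1 : ‖X - 1‖ < 1 := lt_of_le_of_lt hX (by norm_num)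
  have hexp : exp (mlog X) = X := exp_mlog hX1
  have hinv : exp (-mlog X) * X = 1 := by
    calc exp (-mlog X) * X = exp (-mlog X) * exp (mlog X) := by rw [hexp]
      _ = exp (-mlog X + mlog X) := (exp_add_of_commute (Commute.refl (mlog X)).neg_left).symm
      _ = 1 := by rw [neg_add_cancel, exp_zero]
  have hY : Y = exp (-mlog X) := by
    calc Y = exp (-mlog X) * X * Y := by rw [hinv, one_mul]
      _ = exp (-mlog X) := by rw [mul_assoc, hXY, mul_one]
  rw [hY]
  exact B7BlockAvgLog.mlog_exp (by rw [norm_neg]; exact (norm_mlog_le_two_thirds hX).trans_lt two_thirds_lt_log_two)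

/-- **`‖X − 1‖ ≤ e^{‖log X‖} − 1 ≤ 2‖log X‖` when `‖log X‖ ≤ 1`** ((27) with `e^t − 1 ≤ t + t² ≤ 2t` on `[0,1]`).
[cite: Balaban1985Averaging, (27) p.22] -/
theorem norm_sub_one_le_two_mul_norm_mlog_of_le {X : 𝔄} (hX : ‖X - 1‖ < 1) (h1 : ‖mlog X‖ ≤ 1) :
    ‖X - 1‖ ≤ 2 * ‖mlog X‖ := by
  have h := norm_sub_one_le_exp_norm_mlog_sub_one hX
  have h0 : 0 ≤ ‖mlog X‖ := norm_nonneg _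
  have h2 : Real.exp ‖mlog X‖ - 1 ≤ ‖mlog X‖ + ‖mlog X‖ ^ 2 := by
    have := Real.abs_exp_sub_one_sub_id_le (x := ‖mlog X‖) (by rw [abs_of_nonneg h0]; exact h1)
    rw [abs_le] at this
    nlinarith [this.2]
  nlinarith

end

end MatrixLogLipschitz

end Literature.MathematicalPhysics.QuantumFieldTheory.Balaban1983to89
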